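import Mathlib
import HarnessLib
import Summits.HubbardSuperconductivity.HubbardSuperconductivity.Theorems.KLProgrammeKLRegimeEngineScaleZeroIsoKeyed
import Summits.HubbardSuperconductivity.HubbardSuperconductivity.Theorems.KLProgrammeKLRegimeEngineV8DefsG4
import Summits.HubbardSuperconductivity.HubbardSuperconductivity.Theorems.KLProgrammeH10TwoPointLimitIsoTorusSum

/-!
# (E5-S)₀ of `stub_engine_scale0` at the swapped package `klEngGeo4` — UNCONDITIONAL under the stub binders; the scale-`0` rung at
# `(klEngGeo4, klEngQ5 P R)` from (E4)₀ alone

Cell `gate-hubbard-kl`, seat p4 (C5a lead), g7.  Composition of three landed pieces: p4's `TorusFourierL2.exists_isoTorusBoundAt` (the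
isotropic torus bound `∃ T ≥ 0, IsoTorusBoundAt T`, …H10TwoPointLimitIsoTorusSum), p3 g6's keyed scale-`0` rung
(`isoTupleL1AtS_zero_of_isoTorusBoundAt`, `engineScaleZero_of_isoTorusBoundAt_klIsoT`, …EngineScaleZeroIsoKeyed) and the `G`-package swap
`klEngGeo4 = klEngGeo3.raise (klIsoT ^ 4) klE4T` (`klIsoT_pow_four_le_klEngGeo4_CF`, …EngineV8DefsG4):

* **`isoTupleL1AtS_zero_klEngGeo4`** — `IsoTupleL1AtS L M klEngGeo4 P β U μ K 0` under EXACTLY the binders of `stub_engine_scale0`, with NO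
  further hypothesis (the (E5-S)₀ conjunct of the stub at the CASE-S package is closed);
* **`engineScaleZero_klEngGeo4_of_firstMoments`** — the five-clause conclusion of `stub_engine_scale0` at `(klEngGeo4, klEngQ5 P R)` from
  (E4)₀ `EngineFirstMoments L M klEngGeo4 P (klEngQ5 P R) β U μ K 0` alone.

No analysis here; everything is proved upstream. [cite: BenfattoGiulianiMastropietro2006, §2.6 (2.81), §2.8 (2.77)]
-/

namespace Summit.HubbardSuperconductivity.HubbardSuperconductivity.Theorems.EngineV8

set_option linter.dupNamespace false -- summit = problem name (single-conjunct summit), D-0017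

noncomputable section

open Real Finset Literature.MathematicalPhysics.QuantumLattice Literature.Probability.LatticeModels
open Summit.HubbardSuperconductivity.HubbardSuperconductivity.Theorems.KLRegimeSplit
open Summit.HubbardSuperconductivity.HubbardSuperconductivity.Theorems.KLProgrammeLegKernels

/-- **(E5-S)₀ at `klEngGeo4`, unconditionally under the binders of `stub_engine_scale0`**: `IsoTupleL1AtS L M klEngGeo4 P β U μ K 0`.
[cite: BenfattoGiulianiMastropietro2006, §2.6 (2.81)] -/
theorem isoTupleL1AtS_zero_klEngGeo4 (P : SplitConsts) (R : RenConsts) (c : ℝ) (hP : P.WF) (hR : R.WF2) (hc : 0 < c)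
    (hc₃ : c ≤ klEngC₃3 P R) (μ : ℝ) (hμ : μ ∈ klWindowC) (U : ℝ) (hU : 0 < U) (hU₀ : U ≤ klEngU₀3 P R c) (β : ℝ)
    (hβ : klBetaMin ≤ β) (hβc : β ≤ Real.exp (c / U ^ 2)) (K : TrigPolyC4v) (hK : FrameOK R U (nScales β) μ K) (L M : ℕ)
    [NeZero L] [NeZero M] (hL : klEngL₃ β U ≤ L) (hM : klEngM₃ β U L ≤ M) : IsoTupleL1AtS L M klEngGeo4 P β U μ K 0 := by
  obtain ⟨T, h0, h⟩ := TorusFourierL2.exists_isoTorusBoundAt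
  exact isoTupleL1AtS_zero_of_isoTorusBoundAt klIsoT_nonneg (isoTorusBoundAt_klIsoT h0 h) P R c hP hR hc hc₃ μ hμ U hU hU₀ β
    hβ hβc K hK L M hL hM klIsoT_pow_four_le_klEngGeo4_CF

/-- **The scale-`0` rung at `(klEngGeo4, klEngQ5 P R)` from (E4)₀ alone**: under the binders of `stub_engine_scale0`,
`EngineFirstMoments L M klEngGeo4 P (klEngQ5 P R) β U μ K 0` implies the stub's five-clause conclusion (with `klEngGeo4` for `klEngGeo3`).
[cite: BenfattoGiulianiMastropietro2006, §2.8 (2.77)] -/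
theorem engineScaleZero_klEngGeo4_of_firstMoments (P : SplitConsts) (R : RenConsts) (c : ℝ) (hP : P.WF) (hR : R.WF2)
    (hc : 0 < c) (hc₃ : c ≤ klEngC₃3 P R) (μ : ℝ) (hμ : μ ∈ klWindowC) (U : ℝ) (hU : 0 < U) (hU₀ : U ≤ klEngU₀3 P R c)
    (β : ℝ) (hβ : klBetaMin ≤ β) (hβc : β ≤ Real.exp (c / U ^ 2)) (K : TrigPolyC4v) (hK : FrameOK R U (nScales β) μ K)
    (L M : ℕ) [NeZero L] [NeZero M] (hL : klEngL₃ β U ≤ L) (hM : klEngM₃ β U L ≤ M)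
    (hE4 : EngineFirstMoments L M klEngGeo4 P (klEngQ5 P R) β U μ K 0) :
    KernelNormsV4 L M P (klEngQ5 P R) β U μ K 0 ∧ PairLadderStepAtV9 L M klEngGeo4 P (klEngQ5 P R) β U μ K 0 ∧
      QuarticValueUVAtS2 L M klEngGeo4 P (klEngQ5 P R) β U μ K 0 ∧ EngineFirstMoments L M klEngGeo4 P (klEngQ5 P R) β U μ K 0 ∧
        IsoTupleL1AtS L M klEngGeo4 P β U μ K 0 := by
  obtain ⟨T, h0, h⟩ := TorusFourierL2.exists_isoTorusBoundAt
  exact engineScaleZero_of_isoTorusBoundAt_klIsoT h0 h klEngGeo4 klEngGeo4_wf klIsoT_pow_four_le_klEngGeo4_CF P R c hP hR hc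
    hc₃ μ hμ U hU hU₀ β hβ hβc K hK L M hL hM hE4

end

end Summit.HubbardSuperconductivity.HubbardSuperconductivity.Theorems.EngineV8
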